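import Summits.CriticalPhenomena.PercolationContinuityZ3.Theorems.PercNearOneGluingNoHeavyPcintBSMXFourier
import Summits.CriticalPhenomena.PercolationContinuityZ3.Theorems.PercNearOneGluingNoHeavyPcintBSMXTwoSq
import HarnessLib

/-!
# PCINT lane, PHASE 7 (sharp dispersion): Green tails from the Fourier–Laplace bound

Cell `prim-pcint`, seat `prim-pcint-1` (gen 16); memo `run/shared/lean/prim/pcint/T-FIBRE-ROUTE.md` §PHASE 7.

With the near-sharp dispersion bound of …PcintBSMXFourier (`H a₁ a₂ n δ ≤ 1/(2√(π c n)) + e^{-m n}`), the transverse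
factor of the Green series satisfies, for `i ≥ 1`,
`Π_l H (2i) (δ l) ≤ (1/(2√(2π c i)) + r^{2i})² ≤ 1/(8π c i) + (κ + 1) r^{2i}` (`r = e^{-m}`, `κ ≥ 1/√(2π c)`),
whence the tails (**`BSMX.tailBound_two_fourier`**, **`BSMX.tailBound_three_fourier`**):

* `k = 2`: `T = u 2 N · [(2N+2)/(8π c N) + (κ+1) r^{2N}/(1-r²)]` (exact telescoping `Σ_{i ≥ N} u 2 i / i ≤ u 2 N (2N+2)/N`);
* `k ≥ 3`: `T = Cu k q₀ · [1/(8π c N) + (κ+1) r^{2N}/((N+1)(1-r²))]` (`u k i ≤ Cu/(i+1)`, …PcintBSMXTail).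

The constant `1/(8π c)` (`c ≈ a₁ + 4a₂ = σ²/2`) replaces `1/(8 a₁)` of …PcintBSMXDisp/…Tail (`3.7×`–`6×` smaller tails for the
lane's laws).  Kernel discharges from rational data (`π ≥ 3.141592`, `e^{-m} ≤ 1/(1+m)`): **`BSMX.tailBoundH_of_twoFourierQ`**
(square form, `u 2 N ² ≤ 1/(3N+1)`), **`BSMX.tailBoundH_of_threeFourierQ`**; side conditions = the decidable **`BSMX.FourierCheckQ`**.
-/

noncomputable section

namespace Summit.CriticalPhenomena.PercolationContinuityZ3.Theorems.Pcint.BSMX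

open Finset OSM BSM Real

variable {t k : ℕ}

/-! ### The Fourier data -/
/-- **Fourier data**: the hypotheses of `BSMX.H_le_fourier` (with `m > 0`): admissible law with nonnegative
symbol (`4a₁ + 4a₂ ≤ 1`), `0 < θ₀ ≤ 1/2`, `0 < c ≤ (a₁ + 4a₂) - (5/48)(a₁ + 16a₂) θ₀²`,
`0 < m ≤ 2a₁ L(θ₀) + 2a₂ L(2θ₀)`, `m ≤ 2a₁`. -/
def FData (a₁ a₂ θ₀ c m : ℝ) : Prop :=
  Adm a₁ a₂ ∧ 4 * a₁ + 4 * a₂ ≤ 1 ∧ 0 < θ₀ ∧ θ₀ ≤ 1 / 2 ∧ 0 < c ∧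
    c ≤ (a₁ + 4 * a₂) - 5 / 48 * (a₁ + 16 * a₂) * θ₀ ^ 2 ∧ 0 < m ∧
      m ≤ 2 * a₁ * Lcos θ₀ + 2 * a₂ * Lcos (2 * θ₀) ∧ m ≤ 2 * a₁

namespace FData

variable {a₁ a₂ θ₀ c m : ℝ}

/-- admissible law -/
theorem adm (h : FData a₁ a₂ θ₀ c m) : Adm a₁ a₂ := h.1
/-- nonnegative symbol -/
theorem four (h : FData a₁ a₂ θ₀ c m) : 4 * a₁ + 4 * a₂ ≤ 1 := h.2.1
/-- `θ₀ > 0` -/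
theorem θ₀_pos (h : FData a₁ a₂ θ₀ c m) : 0 < θ₀ := h.2.2.1
/-- `θ₀ ≤ 1/2` -/
theorem θ₀_le (h : FData a₁ a₂ θ₀ c m) : θ₀ ≤ 1 / 2 := h.2.2.2.1
/-- `c > 0` -/
theorem c_pos (h : FData a₁ a₂ θ₀ c m) : 0 < c := h.2.2.2.2.1
/-- the quadratic constant -/
theorem c_le (h : FData a₁ a₂ θ₀ c m) : c ≤ (a₁ + 4 * a₂) - 5 / 48 * (a₁ + 16 * a₂) * θ₀ ^ 2 := h.2.2.2.2.2.1
/-- `m > 0` -/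
theorem m_pos (h : FData a₁ a₂ θ₀ c m) : 0 < m := h.2.2.2.2.2.2.1
/-- the gap on region B -/
theorem m_le (h : FData a₁ a₂ θ₀ c m) : m ≤ 2 * a₁ * Lcos θ₀ + 2 * a₂ * Lcos (2 * θ₀) := h.2.2.2.2.2.2.2.1
/-- the gap on region C -/
theorem m_le' (h : FData a₁ a₂ θ₀ c m) : m ≤ 2 * a₁ := h.2.2.2.2.2.2.2.2

end FData

/-- The one-coordinate bound at the pair index: `HB c m i = 1/(2√(π c (2i))) + e^{-m (2i)}`. -/
def HB (c m : ℝ) (i : ℕ) : ℝ := 1 / (2 * Real.sqrt (π * c * (2 * (i : ℝ)))) + Real.exp (-(m * (2 * (i : ℝ))))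

/-- `H (2i) δ ≤ HB i` for `i ≥ 1`. -/
theorem H_two_mul_le_HB {a₁ a₂ θ₀ c m : ℝ} (h : FData a₁ a₂ θ₀ c m) {i : ℕ} (hi : 1 ≤ i) (δ : ℤ) :
    H a₁ a₂ (2 * i) δ ≤ HB c m i := by
  have := H_le_fourier h.adm h.four h.θ₀_pos h.θ₀_le h.c_pos h.c_le h.m_le h.m_le' (n := 2 * i) (by omega) δ
  unfold HB
  push_cast at this
  exact this

/-- `HB ≥ 0`. -/
theorem HB_nonneg (c m : ℝ) (i : ℕ) : 0 ≤ HB c m i := by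
  unfold HB; positivity

/-- The termwise bound: `bF c m κ 0 = 1`, `bF c m κ i = 1/(8π c i) + (κ+1) (e^{-m})^{2i}` for `i ≥ 1`. -/
def bF (c m κ : ℝ) (i : ℕ) : ℝ :=
  if i = 0 then 1 else 1 / (8 * π * c * (i : ℝ)) + (κ + 1) * Real.exp (-m) ^ (2 * i)

/-- **`HB i ² ≤ 1/(8π c i) + (κ+1) r^{2i}`** for `i ≥ 1`, `κ ≥ 0`, `κ² (2π c) ≥ 1`, `m ≥ 0`. -/
theorem HB_sq_le {c m κ : ℝ} (hc : 0 < c) (hm : 0 ≤ m) (hκ : 0 ≤ κ) (hκ2 : 1 ≤ κ ^ 2 * (2 * π * c)) {i : ℕ}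
    (hi : 1 ≤ i) : HB c m i ^ 2 ≤ 1 / (8 * π * c * (i : ℝ)) + (κ + 1) * Real.exp (-m) ^ (2 * i) := by
  have hπ := Real.pi_pos
  have hiR : (1 : ℝ) ≤ i := by exact_mod_cast hi
  set S := Real.sqrt (π * c * (2 * (i : ℝ))) with hS
  have hS0 : 0 < S := Real.sqrt_pos.2 (by positivity)
  have hS2 : S ^ 2 = π * c * (2 * (i : ℝ)) := Real.sq_sqrt (by positivity)
  set E := Real.exp (-(m * (2 * (i : ℝ)))) with hE
  have hE' : E = Real.exp (-m) ^ (2 * i) := by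
    rw [hE, ← Real.exp_nat_mul]; push_cast; ring_nf
  have hE0 : 0 ≤ E := (Real.exp_pos _).le
  have hE1 : E ≤ 1 := by rw [hE]; exact Real.exp_le_one_iff.2 (by nlinarith)
  -- `1/S ≤ κ`: `(κ S)² = κ² (2π c) · i ≥ κ² (2π c) ≥ 1`
  have hκS : 1 ≤ κ * S := by
    have h1 : 1 ≤ (κ * S) ^ 2 := by
      rw [mul_pow, hS2]; nlinarith [mul_le_mul_of_nonneg_left hiR (by positivity : 0 ≤ κ ^ 2 * (2 * π * c))]
    nlinarith [sq_nonneg (κ * S - 1), mul_nonneg hκ hS0.le]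
  have hA : (1 / (2 * S)) ^ 2 = 1 / (8 * π * c * (i : ℝ)) := by
    rw [div_pow, mul_pow, hS2]; ring
  unfold HB
  rw [← hS, ← hE, ← hE', add_sq, hA]
  have hcross : 2 * (1 / (2 * S)) * E ≤ κ * E := by
    rw [show 2 * (1 / (2 * S)) * E = E / S by field_simp]
    rw [div_le_iff₀ hS0]
    nlinarith [mul_nonneg hE0 (by linarith : (0 : ℝ) ≤ κ * S - 1)]
  nlinarith [mul_le_mul_of_nonneg_left hE1 hE0]

/-- **The transverse factor bound**: `Π_l H (2i) (δ l) ≤ bF i` (`t ≥ 2`). -/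
theorem prod_H_le_bF {a₁ a₂ θ₀ c m κ : ℝ} (h : FData a₁ a₂ θ₀ c m) (hκ : 0 ≤ κ) (hκ2 : 1 ≤ κ ^ 2 * (2 * π * c))
    (ht : 2 ≤ t) (i : ℕ) (δ : Fin t → ℤ) : ∏ l, H a₁ a₂ (2 * i) (δ l) ≤ bF c m κ i := by
  unfold bF
  split_ifs with hi
  · exact prod_H_le_one h.adm _ δ
  · have hi1 : 1 ≤ i := Nat.one_le_iff_ne_zero.2 hi
    refine (prod_H_le_two h.adm ht (2 * i) δ).trans ?_
    have h0 := fun l => H_nonneg h.adm.a₁_nonneg h.adm.nonneg h.adm.two_le (2 * i) (δ l)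
    have e0 := H_two_mul_le_HB h hi1 (δ ⟨0, by omega⟩)
    have e1 := H_two_mul_le_HB h hi1 (δ ⟨1, by omega⟩)
    calc H a₁ a₂ (2 * i) (δ ⟨0, by omega⟩) * H a₁ a₂ (2 * i) (δ ⟨1, by omega⟩) ≤ HB c m i * HB c m i :=
          mul_le_mul e0 e1 (h0 _) (HB_nonneg c m i)
      _ = HB c m i ^ 2 := (sq _).symm
      _ ≤ _ := HB_sq_le h.c_pos h.m_pos.le hκ hκ2 hi1

/-! ### Two time axes -/
/-- `Σ_{i ∈ [N,M)} u 2 i / i ≤ u 2 N (2N+2)/N` for `N ≥ 1` (exact telescoping, …PcintBSMXTail). -/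
theorem window_two_inv {N : ℕ} (hN : 1 ≤ N) (M : ℕ) :
    ∑ i ∈ Ico N M, u 2 i / (i : ℝ) ≤ u 2 N * (2 * (N : ℝ) + 2) / N := by
  have hNR : (1 : ℝ) ≤ N := by exact_mod_cast hN
  have hw := window_two (a₁ := 1 / 4) (by norm_num) N M
  simp only [show (4 : ℝ) * (1 / 4) = 1 by norm_num, mul_one] at hw
  -- termwise `u i / i ≤ ((2N+1)/N) · u i / (2i+1)` for `i ≥ N`
  have hterm : ∀ i ∈ Ico N M, u 2 i / (i : ℝ) ≤ (2 * (N : ℝ) + 1) / N * (u 2 i / (2 * (i : ℝ) + 1)) := by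
    intro i hi
    have hNi : (N : ℝ) ≤ i := by exact_mod_cast (mem_Ico.1 hi).1
    have hi0 : (0 : ℝ) < i := by linarith
    have hu := u_nonneg (d := 2) i
    rw [div_mul_div_comm, div_le_div_iff₀ hi0 (by positivity)]
    nlinarith [mul_nonneg hu (sub_nonneg.2 hNi)]
  calc ∑ i ∈ Ico N M, u 2 i / (i : ℝ) ≤ ∑ i ∈ Ico N M, (2 * (N : ℝ) + 1) / N * (u 2 i / (2 * (i : ℝ) + 1)) :=
        sum_le_sum hterm
    _ = (2 * (N : ℝ) + 1) / N * ∑ i ∈ Ico N M, u 2 i / (2 * (i : ℝ) + 1) := by rw [mul_sum]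
    _ ≤ (2 * (N : ℝ) + 1) / N * (u 2 N * (2 * (N : ℝ) + 2) / (2 * (N : ℝ) + 1)) :=
        mul_le_mul_of_nonneg_left hw (by positivity)
    _ = u 2 N * (2 * (N : ℝ) + 2) / N := by field_simp

/-- **The Fourier tail for two time axes**: any
`T ≥ u 2 N · [(2N+2)/(8π c N) + (κ+1) r^{2N}/(1-r²)]`, `r = e^{-m}`, is a tail bound (`t ≥ 2`, `N ≥ 1`). -/
theorem tailBound_two_fourier {a₁ a₂ θ₀ c m κ : ℝ} (h : FData a₁ a₂ θ₀ c m) (hκ : 0 ≤ κ)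
    (hκ2 : 1 ≤ κ ^ 2 * (2 * π * c)) (ht : 2 ≤ t) {N : ℕ} (hN : 1 ≤ N) {T : ℝ}
    (hT : u 2 N * ((2 * (N : ℝ) + 2) / (8 * π * c * N) + (κ + 1) * Real.exp (-m) ^ (2 * N) / (1 - Real.exp (-m) ^ 2)) ≤ T) :
    TailBoundH t 2 a₁ a₂ N T := by
  have hπ := Real.pi_pos; have hc := h.c_pos
  set r := Real.exp (-m) with hr
  have hr0 : 0 ≤ r := (Real.exp_pos _).le
  have hr1 : r < 1 := Real.exp_lt_one_iff.2 (by linarith [h.m_pos])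
  have hr2 : 0 < 1 - r ^ 2 := by nlinarith
  have huN := u_nonneg (d := 2) N
  have hT0 : 0 ≤ u 2 N * ((2 * (N : ℝ) + 2) / (8 * π * c * N) + (κ + 1) * r ^ (2 * N) / (1 - r ^ 2)) := by positivity
  refine tailBoundH_of_window' h.adm le_rfl (fun i δ => prod_H_le_bF h hκ hκ2 ht i δ) (hT0.trans hT) fun M => le_trans ?_ hT
  -- on the window every index is `≥ N ≥ 1`, so `bF i` is the second branch
  have hsplit : ∑ i ∈ Ico N M, u 2 i * bF c m κ i =
      (1 / (8 * π * c)) * ∑ i ∈ Ico N M, u 2 i / (i : ℝ) + (κ + 1) * ∑ i ∈ Ico N M, u 2 i * r ^ (2 * i) := by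
    rw [mul_sum, mul_sum, ← sum_add_distrib]
    refine sum_congr rfl fun i hi => ?_
    have hi1 : i ≠ 0 := by have := (mem_Ico.1 hi).1; omega
    have hi0 : (0 : ℝ) < i := by exact_mod_cast Nat.pos_of_ne_zero hi1
    rw [bF, if_neg hi1, hr]
    field_simp
  rw [hsplit]
  have h1 := window_two_inv hN M
  have h2 := window_geo hr0 hr1 N M
  have hNR : (0 : ℝ) < N := by exact_mod_cast hN
  calc 1 / (8 * π * c) * ∑ i ∈ Ico N M, u 2 i / (i : ℝ) + (κ + 1) * ∑ i ∈ Ico N M, u 2 i * r ^ (2 * i)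
      ≤ 1 / (8 * π * c) * (u 2 N * (2 * (N : ℝ) + 2) / N) + (κ + 1) * (u 2 N * r ^ (2 * N) / (1 - r ^ 2)) :=
        add_le_add (mul_le_mul_of_nonneg_left h1 (by positivity)) (mul_le_mul_of_nonneg_left h2 (by positivity))
    _ = u 2 N * ((2 * (N : ℝ) + 2) / (8 * π * c * N) + (κ + 1) * r ^ (2 * N) / (1 - r ^ 2)) := by
        field_simp

/-! ### Three or more time axes -/
/-- The geometric window with the `1/(i+1)` weight: `Σ_{i ∈ [N,M)} r^{2i}/(i+1) ≤ r^{2N}/((N+1)(1-r²))`. -/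
theorem window_geo_div {r : ℝ} (hr0 : 0 ≤ r) (hr1 : r < 1) (N M : ℕ) :
    ∑ i ∈ Ico N M, r ^ (2 * i) / ((i : ℝ) + 1) ≤ r ^ (2 * N) / (((N : ℝ) + 1) * (1 - r ^ 2)) := by
  have hr2 : r ^ 2 < 1 := by nlinarith
  have h1r : 0 < 1 - r ^ 2 := by linarith
  calc ∑ i ∈ Ico N M, r ^ (2 * i) / ((i : ℝ) + 1) ≤ ∑ i ∈ Ico N M, r ^ (2 * i) / ((N : ℝ) + 1) := by
        refine sum_le_sum fun i hi => ?_
        have hNi : (N : ℝ) ≤ i := by exact_mod_cast (mem_Ico.1 hi).1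
        exact div_le_div_of_nonneg_left (by positivity) (by positivity) (by linarith)
    _ = (∑ i ∈ Ico N M, (r ^ 2) ^ i) / ((N : ℝ) + 1) := by
        rw [sum_div]; exact sum_congr rfl fun i _ => by rw [pow_mul]
    _ ≤ ((r ^ 2) ^ N / (1 - r ^ 2)) / ((N : ℝ) + 1) :=
        div_le_div_of_nonneg_right (geom_sum_Ico_le_of_lt_one (sq_nonneg r) hr2) (by positivity)
    _ = r ^ (2 * N) / (((N : ℝ) + 1) * (1 - r ^ 2)) := by rw [← pow_mul, div_div]; ring

/-- **The Fourier tail for `k ≥ 3` time axes**: any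
`T ≥ Cu k q₀ · [1/(8π c N) + (κ+1) r^{2N}/((N+1)(1-r²))]`, `r = e^{-m}`, is a tail bound (`N ≥ q₀ k`, `N ≥ 1`, `t ≥ 2`). -/
theorem tailBound_three_fourier {a₁ a₂ θ₀ c m κ : ℝ} (h : FData a₁ a₂ θ₀ c m) (hκ : 0 ≤ κ)
    (hκ2 : 1 ≤ κ ^ 2 * (2 * π * c)) (hk : 3 ≤ k) (ht : 2 ≤ t) {q₀ N : ℕ} (hN : q₀ * k ≤ N) (hN1 : 1 ≤ N) {T : ℝ}
    (hT : Cu k q₀ * (1 / (8 * π * c * N) + (κ + 1) * Real.exp (-m) ^ (2 * N) / (((N : ℝ) + 1) * (1 - Real.exp (-m) ^ 2))) ≤ T) :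
    TailBoundH t k a₁ a₂ N T := by
  have hπ := Real.pi_pos; have hc := h.c_pos
  have hk0 : 0 < k := by omega
  set r := Real.exp (-m) with hr
  have hr0 : 0 ≤ r := (Real.exp_pos _).le
  have hr1 : r < 1 := Real.exp_lt_one_iff.2 (by linarith [h.m_pos])
  have hr2 : 0 < 1 - r ^ 2 := by nlinarith
  have hC := Cu_nonneg hk0 q₀
  have hT0 : 0 ≤ Cu k q₀ * (1 / (8 * π * c * N) + (κ + 1) * r ^ (2 * N) / (((N : ℝ) + 1) * (1 - r ^ 2))) := by
    positivity
  refine tailBoundH_of_window' h.adm (by omega) (fun i δ => prod_H_le_bF h hκ hκ2 ht i δ) (hT0.trans hT)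
    fun M => le_trans ?_ hT
  -- termwise: `u k i · bF i ≤ Cu/(8πc) (1/i - 1/(i+1)) + (κ+1) Cu · r^{2i}/(i+1)`
  have hterm : ∀ i ∈ Ico N M, u k i * bF c m κ i ≤
      Cu k q₀ / (8 * π * c) * (1 / (i : ℝ) - 1 / ((i : ℝ) + 1)) + (κ + 1) * Cu k q₀ * (r ^ (2 * i) / ((i : ℝ) + 1)) := by
    intro i hi
    have hNi := (mem_Ico.1 hi).1
    have hi1 : i ≠ 0 := by omega
    have hi0 : (0 : ℝ) < i := by exact_mod_cast Nat.pos_of_ne_zero hi1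
    have hu := u_mul_le hk (hN.trans hNi)   -- `u k i (i+1) ≤ Cu`
    have hu' : u k i ≤ Cu k q₀ / ((i : ℝ) + 1) := by rw [le_div_iff₀ (by positivity)]; unfold Cu; linarith
    have hii : 1 / (i : ℝ) - 1 / ((i : ℝ) + 1) = 1 / ((i : ℝ) * ((i : ℝ) + 1)) := by field_simp; ring
    rw [bF, if_neg hi1, ← hr, hii]
    have hb0 : 0 ≤ 1 / (8 * π * c * (i : ℝ)) + (κ + 1) * r ^ (2 * i) := by positivity
    calc u k i * (1 / (8 * π * c * (i : ℝ)) + (κ + 1) * r ^ (2 * i))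
        ≤ Cu k q₀ / ((i : ℝ) + 1) * (1 / (8 * π * c * (i : ℝ)) + (κ + 1) * r ^ (2 * i)) :=
          mul_le_mul_of_nonneg_right hu' hb0
      _ = Cu k q₀ / (8 * π * c) * (1 / ((i : ℝ) * ((i : ℝ) + 1))) + (κ + 1) * Cu k q₀ * (r ^ (2 * i) / ((i : ℝ) + 1)) := by
          field_simp
  have h1 := sum_Ico_telescope_le N M
  have h2 := window_geo_div hr0 hr1 N M
  have hNR : (0 : ℝ) < N := by exact_mod_cast hN1
  calc ∑ i ∈ Ico N M, u k i * bF c m κ i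
      ≤ ∑ i ∈ Ico N M, (Cu k q₀ / (8 * π * c) * (1 / (i : ℝ) - 1 / ((i : ℝ) + 1)) +
          (κ + 1) * Cu k q₀ * (r ^ (2 * i) / ((i : ℝ) + 1))) := sum_le_sum hterm
    _ = Cu k q₀ / (8 * π * c) * ∑ i ∈ Ico N M, (1 / (i : ℝ) - 1 / ((i : ℝ) + 1)) +
          (κ + 1) * Cu k q₀ * ∑ i ∈ Ico N M, r ^ (2 * i) / ((i : ℝ) + 1) := by
        rw [sum_add_distrib, mul_sum, mul_sum]
    _ ≤ Cu k q₀ / (8 * π * c) * (1 / (N : ℝ)) + (κ + 1) * Cu k q₀ * (r ^ (2 * N) / (((N : ℝ) + 1) * (1 - r ^ 2))) :=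
        add_le_add (mul_le_mul_of_nonneg_left h1 (by positivity)) (mul_le_mul_of_nonneg_left h2 (by positivity))
    _ = Cu k q₀ * (1 / (8 * π * c * N) + (κ + 1) * r ^ (2 * N) / (((N : ℝ) + 1) * (1 - r ^ 2))) := by
        field_simp

/-! ### Kernel discharges from rational data -/
/-- `Lcos` over `ℚ`. -/
def LcosQ (x : ℚ) : ℚ := x ^ 2 / 2 - 5 / 96 * x ^ 4

/-- `LcosQ` casts to `Lcos`. -/
theorem LcosQ_cast (x : ℚ) : ((LcosQ x : ℚ) : ℝ) = Lcos x := by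
  unfold LcosQ Lcos; push_cast; ring

/-- The rational lower bound for `π` used by the kernel checks. -/
def piLo : ℚ := 3141592 / 1000000

/-- `piLo ≤ π`. -/
theorem piLo_le_pi : ((piLo : ℚ) : ℝ) ≤ π := by
  have := Real.pi_gt_d6; unfold piLo; push_cast; linarith

/-- **The decidable side conditions** of the Fourier data for the law `(A₁, A₂)/DA` with rational `θ₀, c, m` and a
rational `κ` with `κ² (2 piLo c) ≥ 1` (so `κ ≥ 1/√(2π c)`). -/
def FourierCheckQ (A1 A2 DA : ℕ) (θ₀ c m κ : ℚ) : Prop :=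
  4 * A1 + 4 * A2 ≤ DA ∧ 0 < θ₀ ∧ θ₀ ≤ 1 / 2 ∧ 0 < c ∧
    c ≤ ((A1 : ℚ) / DA + 4 * ((A2 : ℚ) / DA)) - 5 / 48 * ((A1 : ℚ) / DA + 16 * ((A2 : ℚ) / DA)) * θ₀ ^ 2 ∧ 0 < m ∧
      m ≤ 2 * ((A1 : ℚ) / DA) * LcosQ θ₀ + 2 * ((A2 : ℚ) / DA) * LcosQ (2 * θ₀) ∧ m ≤ 2 * ((A1 : ℚ) / DA) ∧
        0 ≤ κ ∧ 1 ≤ κ ^ 2 * (2 * piLo * c)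

/-- **From the rational checks to the Fourier data** (and the real inequality `κ² (2π c) ≥ 1`). -/
theorem fdata_of_checkQ {A0 A1 A2 DA : ℕ} (hDA : A0 + 2 * A1 + 2 * A2 = DA) (hA1 : 0 < A1) (hA4 : 4 * A1 + 2 * A2 ≤ DA)
    {θ₀ c m κ : ℚ} (hq : FourierCheckQ A1 A2 DA θ₀ c m κ) :
    FData ((A1 : ℝ) / DA) ((A2 : ℝ) / DA) θ₀ c m ∧ 0 ≤ (κ : ℝ) ∧ 1 ≤ (κ : ℝ) ^ 2 * (2 * π * c) := by
  obtain ⟨h4, hθ0, hθ1, hc0, hc1, hm0, hm1, hm2, hκ0, hκ1⟩ := hq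
  have hadm := adm_of_nat hDA hA1 hA4
  have hDAR : (0 : ℝ) < DA := by exact_mod_cast (by omega : 0 < DA)
  have e4 : 4 * ((A1 : ℝ) / DA) + 4 * ((A2 : ℝ) / DA) ≤ 1 := by
    rw [show 4 * ((A1 : ℝ) / DA) + 4 * ((A2 : ℝ) / DA) = (4 * A1 + 4 * A2 : ℝ) / DA by ring, div_le_one hDAR]
    exact_mod_cast h4
  have eθ0 : (0 : ℝ) < θ₀ := by exact_mod_cast hθ0
  have eθ1 : (θ₀ : ℝ) ≤ 1 / 2 := by have := (Rat.cast_le (K := ℝ)).2 hθ1; push_cast at this; exact this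
  have ec0 : (0 : ℝ) < c := by exact_mod_cast hc0
  have ec1 : (c : ℝ) ≤ ((A1 : ℝ) / DA + 4 * ((A2 : ℝ) / DA)) - 5 / 48 * ((A1 : ℝ) / DA + 16 * ((A2 : ℝ) / DA)) * (θ₀ : ℝ) ^ 2 := by
    have := (Rat.cast_le (K := ℝ)).2 hc1; push_cast at this; exact this
  have em0 : (0 : ℝ) < m := by exact_mod_cast hm0
  have em1 : (m : ℝ) ≤ 2 * ((A1 : ℝ) / DA) * Lcos θ₀ + 2 * ((A2 : ℝ) / DA) * Lcos (2 * θ₀) := by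
    have := (Rat.cast_le (K := ℝ)).2 hm1; push_cast at this; rw [LcosQ_cast, LcosQ_cast] at this; push_cast at this
    exact this
  have em2 : (m : ℝ) ≤ 2 * ((A1 : ℝ) / DA) := by have := (Rat.cast_le (K := ℝ)).2 hm2; push_cast at this; exact this
  have eκ0 : (0 : ℝ) ≤ κ := by exact_mod_cast hκ0
  have eκ1 : (1 : ℝ) ≤ (κ : ℝ) ^ 2 * (2 * ((piLo : ℚ) : ℝ) * c) := by
    have := (Rat.cast_le (K := ℝ)).2 hκ1; push_cast at this ⊢; exact this
  refine ⟨⟨hadm, e4, eθ0, eθ1, ec0, ec1, em0, em1, em2⟩, eκ0, eκ1.trans ?_⟩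
  have hp := piLo_le_pi
  have : 0 ≤ (κ : ℝ) ^ 2 * (2 * c) := by positivity
  nlinarith [mul_le_mul_of_nonneg_left hp this]

/-- Monotonicity of the geometric factor: `r^{2N}/(1-r²) ≤ ρ^{2M}/(1-ρ²)` for `0 ≤ r ≤ ρ < 1`, `M ≤ N`. -/
theorem geo_factor_le {r ρ : ℝ} (hr0 : 0 ≤ r) (hrρ : r ≤ ρ) (hρ1 : ρ < 1) {M N : ℕ} (hMN : M ≤ N) :
    r ^ (2 * N) / (1 - r ^ 2) ≤ ρ ^ (2 * M) / (1 - ρ ^ 2) := by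
  have hρ0 : 0 ≤ ρ := hr0.trans hrρ
  have h1 : r ^ (2 * N) ≤ ρ ^ (2 * N) := pow_le_pow_left₀ hr0 hrρ _
  have h2 : ρ ^ (2 * N) ≤ ρ ^ (2 * M) := pow_le_pow_of_le_one hρ0 hρ1.le (by omega)
  have h3 : 1 - ρ ^ 2 ≤ 1 - r ^ 2 := by nlinarith [pow_le_pow_left₀ hr0 hrρ 2]
  exact div_le_div₀ (pow_nonneg hρ0 _) (h1.trans h2) (by nlinarith) h3

/-- The real tail expression for two time axes is below its rational majorant
(`π ≥ piLo`, `e^{-m} ≤ ρ = 1/(1+m)`, exponent `2M ≤ 2N`). -/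
theorem twoX_le {c m κ : ℝ} (hc : 0 < c) (hm : 0 < m) (hκ : 0 ≤ κ) {M N : ℕ} (hMN : M ≤ N) (hN : 1 ≤ N) :
    (2 * (N : ℝ) + 2) / (8 * π * c * N) + (κ + 1) * Real.exp (-m) ^ (2 * N) / (1 - Real.exp (-m) ^ 2) ≤
      (2 * (N : ℝ) + 2) / (8 * ((piLo : ℚ) : ℝ) * c * N) +
        (κ + 1) * (1 / (1 + m)) ^ (2 * M) / (1 - (1 / (1 + m)) ^ 2) := by
  have hp := piLo_le_pi
  have hp0 : (0 : ℝ) < ((piLo : ℚ) : ℝ) := by unfold piLo; push_cast; norm_num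
  have hNR : (0 : ℝ) < N := by exact_mod_cast hN
  have hρ1 : 1 / (1 + m) < 1 := by rw [div_lt_one (by linarith)]; linarith
  have hr : Real.exp (-m) ≤ 1 / (1 + m) := by
    rw [Real.exp_neg, inv_eq_one_div]; exact one_div_le_one_div_of_le (by linarith) (by linarith [Real.add_one_le_exp m])
  have hg := geo_factor_le (Real.exp_pos _).le hr hρ1 hMN
  have h1 : (2 * (N : ℝ) + 2) / (8 * π * c * N) ≤ (2 * (N : ℝ) + 2) / (8 * ((piLo : ℚ) : ℝ) * c * N) :=
    div_le_div_of_nonneg_left (by positivity) (by positivity) (by gcongr)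
  rw [mul_div_assoc, mul_div_assoc]
  exact add_le_add h1 (mul_le_mul_of_nonneg_left hg (by positivity))

/-- **The Fourier two-axes tail from a kernel check** (square form): with `ρ = 1/(1+m)`,
`X = (2N+2)/(8 piLo c N) + (κ+1) ρ^{2M}/(1-ρ²)` (`M ≤ N`), the check `X² ≤ (Tn/DG)² (3N+1)` gives the tail bound
`Tn/DG` at horizon `N ≥ 1` (using `u 2 N ² ≤ 1/(3N+1)`). -/
theorem tailBoundH_of_twoFourierQ (ht : 2 ≤ t) {A0 A1 A2 DA : ℕ} (hDA : A0 + 2 * A1 + 2 * A2 = DA) (hA1 : 0 < A1)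
    (hA4 : 4 * A1 + 2 * A2 ≤ DA) {θ₀ c m κ : ℚ} (hq : FourierCheckQ A1 A2 DA θ₀ c m κ) {M N : ℕ} (hMN : M ≤ N)
    (hN : 1 ≤ N) {Tn DG : ℕ}
    (h : ((2 * (N : ℚ) + 2) / (8 * piLo * c * N) + (κ + 1) * (1 / (1 + m)) ^ (2 * M) / (1 - (1 / (1 + m)) ^ 2)) ^ 2 ≤
      ((Tn : ℚ) / DG) ^ 2 * (3 * (N : ℚ) + 1)) :
    TailBoundH t 2 ((A1 : ℝ) / DA) ((A2 : ℝ) / DA) N ((Tn : ℝ) / DG) := by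
  obtain ⟨hF, hκ0, hκ1⟩ := fdata_of_checkQ hDA hA1 hA4 hq
  set Xρ : ℝ := (2 * (N : ℝ) + 2) / (8 * ((piLo : ℚ) : ℝ) * c * N) +
    ((κ : ℝ) + 1) * (1 / (1 + (m : ℝ))) ^ (2 * M) / (1 - (1 / (1 + (m : ℝ))) ^ 2) with hXρ
  have h' := (Rat.cast_le (K := ℝ)).2 h
  push_cast at h'
  have hX' : Xρ ^ 2 ≤ ((Tn : ℝ) / DG) ^ 2 * (3 * (N : ℝ) + 1) := by rw [hXρ]; exact h'
  have hmR : (0 : ℝ) < m := hF.m_pos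
  have hp0 : (0 : ℝ) < ((piLo : ℚ) : ℝ) := by unfold piLo; push_cast; norm_num
  have hρ1 : (1 : ℝ) / (1 + m) < 1 := by rw [div_lt_one (by linarith)]; linarith
  have hX0 : 0 ≤ Xρ := by
    have hcR : (0 : ℝ) < c := hF.c_pos
    have hNR : (0 : ℝ) < N := by exact_mod_cast hN
    have : 0 < 1 - ((1 : ℝ) / (1 + m)) ^ 2 := by nlinarith [(by positivity : (0 : ℝ) ≤ 1 / (1 + m))]
    positivity
  refine tailBound_two_fourier hF hκ0 hκ1 ht hN ?_
  have huN := u_nonneg (d := 2) N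
  have hT0 : 0 ≤ (Tn : ℝ) / DG := by positivity
  have hle := twoX_le hF.c_pos hmR hκ0 hMN hN
  have h1 : (u 2 N * Xρ) ^ 2 ≤ ((Tn : ℝ) / DG) ^ 2 := by
    rw [mul_pow]
    calc u 2 N ^ 2 * Xρ ^ 2 ≤ 1 / (3 * (N : ℝ) + 1) * (((Tn : ℝ) / DG) ^ 2 * (3 * (N : ℝ) + 1)) :=
          mul_le_mul (u_two_sq_le N) hX' (by positivity) (by positivity)
      _ = ((Tn : ℝ) / DG) ^ 2 := by field_simp
  have h2 : u 2 N * Xρ ≤ (Tn : ℝ) / DG := (pow_le_pow_iff_left₀ (mul_nonneg huN hX0) hT0 two_ne_zero).1 h1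
  exact (mul_le_mul_of_nonneg_left (hle.trans (le_of_eq (by rw [hXρ]))) huN).trans h2

/-- **The Fourier `k ≥ 3` tail from a kernel check**: with `ρ = 1/(1+m)`,
`k · BQ k q₀ · (q₀+1) · [1/(8 piLo c N) + (κ+1) ρ^{2M}/((N+1)(1-ρ²))] ≤ Tn/DG` (`M ≤ N`, `N ≥ q₀ k`, `N ≥ 1`). -/
theorem tailBoundH_of_threeFourierQ (hk : 3 ≤ k) (ht : 2 ≤ t) {A0 A1 A2 DA : ℕ} (hDA : A0 + 2 * A1 + 2 * A2 = DA)
    (hA1 : 0 < A1) (hA4 : 4 * A1 + 2 * A2 ≤ DA) {θ₀ c m κ : ℚ} (hq : FourierCheckQ A1 A2 DA θ₀ c m κ)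
    {q₀ M N : ℕ} (hN : q₀ * k ≤ N) (hN1 : 1 ≤ N) (hMN : M ≤ N) {Tn DG : ℕ}
    (h : (k : ℚ) * BQ k q₀ * ((q₀ : ℚ) + 1) *
        (1 / (8 * piLo * c * N) + (κ + 1) * (1 / (1 + m)) ^ (2 * M) / (((N : ℚ) + 1) * (1 - (1 / (1 + m)) ^ 2))) ≤
      (Tn : ℚ) / DG) :
    TailBoundH t k ((A1 : ℝ) / DA) ((A2 : ℝ) / DA) N ((Tn : ℝ) / DG) := by
  obtain ⟨hF, hκ0, hκ1⟩ := fdata_of_checkQ hDA hA1 hA4 hq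
  have hk0 : 0 < k := by omega
  have h' := (Rat.cast_le (K := ℝ)).2 h
  push_cast at h'
  rw [BQ_cast] at h'
  have hmR : (0 : ℝ) < m := hF.m_pos
  have hcR : (0 : ℝ) < c := hF.c_pos
  have hNR : (0 : ℝ) < N := by exact_mod_cast hN1
  have hp := piLo_le_pi
  have hp0 : (0 : ℝ) < ((piLo : ℚ) : ℝ) := by unfold piLo; push_cast; norm_num
  have hρ1 : (1 : ℝ) / (1 + m) < 1 := by rw [div_lt_one (by linarith)]; linarith
  refine tailBound_three_fourier hF hκ0 hκ1 hk ht hN hN1 (le_trans ?_ h')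
  have hC : 0 ≤ Cu k q₀ := Cu_nonneg hk0 q₀
  unfold Cu
  rw [show (k : ℝ) * B k q₀ * ((q₀ : ℝ) + 1) = Cu k q₀ from rfl]
  refine mul_le_mul_of_nonneg_left (add_le_add ?_ ?_) hC
  · exact div_le_div_of_nonneg_left (by positivity) (by positivity) (by gcongr)
  · have hr : Real.exp (-(m : ℝ)) ≤ 1 / (1 + m) := by
      rw [Real.exp_neg, inv_eq_one_div]
      exact one_div_le_one_div_of_le (by linarith) (by linarith [Real.add_one_le_exp (m : ℝ)])
    have hg := geo_factor_le (Real.exp_pos (-(m : ℝ))).le hr hρ1 hMN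
    rw [mul_div_assoc, mul_div_assoc]
    refine mul_le_mul_of_nonneg_left ?_ (by positivity)
    have := div_le_div_of_nonneg_right hg (by positivity : (0 : ℝ) ≤ (N : ℝ) + 1)
    rw [div_div, div_div, mul_comm (1 - Real.exp (-(m : ℝ)) ^ 2), mul_comm (1 - ((1 : ℝ) / (1 + m)) ^ 2)] at this
    exact this

end Summit.CriticalPhenomena.PercolationContinuityZ3.Theorems.Pcint.BSMX

end
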